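import Summits.Ventures.Crystal3D.Theorems.StickyWulffConstantPolycrystalWulffBoundRungRelabel

/-!
# `PolycrystalWulffBound`, line `PolyDensity`: CELL-LEVEL relabelling — parts of a grain may be flipped
# (crux `stmt-Ventures-19482`)

Route `StickyWulffConstant` of the venture `Summits/Ventures/Crystal3D`, second prover lane (poly-p2,
gen 11).  `rung_relabel_texture` (`…RungRelabel`) relabels whole grains.  The slide engine works per CELL,
so the relabelling may be chosen PER CELL of the presenting complex: a grain may be cut (by the cell
complex) into parts treated with different bodies.  A cut between cells of one grain that end up in
different relabelled classes is charged by the slide `(2/√6)|⟪w, ν⟫|·fa` only — FREE when the cut plane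
contains `w` (e.g. horizontal cuts, or vertical cuts containing `w`) — and a flipped cell pays `(1/√6)×`
its sin-weighted TRUE exterior area (cell–cell facets inside a grain are interfaces of the complex, not
exterior).  `rung_relabel_cells` is the cell-vocabulary form (true cell frames arbitrary, relabelled cell
frames pairwise `Ax m`); `rung_relabel_cells_texture` the crux form (`Tex`/`En`, wall budget read off the
texture's own wall data as in `…RungRelabel`).
WHAT THIS IS NOT: a closing of the single-axis residual (thick balanced lamellae) — pleated/horizontal free
cuts make thin wedges flippable, not thick slabs; the crux is not claimed.
-/

noncomputable section

open scoped BigOperators InnerProductSpace ENNReal Pointwise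
open MeasureTheory Filter Set

namespace Summit.Ventures.Crystal3D.Cruxes.PolycrystalWulffBound.PolyDensity

open Summit.Ventures.Crystal3D.Theorems
open Summit.Ventures.Crystal3D.Cruxes.TextureLiminf.TexShadow (per polytope facetArea supportFn E3
  PolytopeCalculus stub_polytopeCalculus)
open Literature.MathematicalPhysics.StatisticalMechanics (fccStacking barlowStacking IsHaggSeq perimeter)

/-- **Cell-level relabelling rung** (`rung_relabel_cells`): the slide rung on RELABELLED cell frames `A'`
plus the sharp body change, in the cell vocabulary of `rung_singleAxis_cells`.  The true frames `A j` are
arbitrary; the relabelled ones are pairwise `Ax m` with one admissible (bond, `⟨112⟩`) pair; each flipped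
cell `j ∈ T` carries an axis `ax j` and the gap hypothesis.  Conclusion:
`6·2^{1/3}(√2·Vol)^{2/3} ≤ Fr(A) + (1/√6)·Σ_{j ∈ T} Fr_{Dsc(ax j)}(j) + (1/√6)·Σ_{τ' j ≠ τ' j'} |⟪w, ν_{jj'}⟫|·fa`. -/
theorem rung_relabel_cells : let Λ : Set (EuclideanSpace ℝ (Fin 3)) := Literature.MathematicalPhysics.StatisticalMechanics.fccStacking 1 (Real.sqrt (2 / 3)); let Brl : (ℤ → ℤ) → Set (EuclideanSpace ℝ (Fin 3)) := Literature.MathematicalPhysics.StatisticalMechanics.barlowStacking 1 (Real.sqrt (2 / 3)); let Ax : EuclideanSpace ℝ (Fin 3) → (EuclideanSpace ℝ (Fin 3) ≃ₗᵢ[ℝ] EuclideanSpace ℝ (Fin 3)) → (EuclideanSpace ℝ (Fin 3) ≃ₗᵢ[ℝ] EuclideanSpace ℝ (Fin 3)) → Prop := fun m A B => ∃ (L : EuclideanSpace ℝ (Fin 3) ≃ₗᵢ[ℝ] EuclideanSpace ℝ (Fin 3)) (s₁ s₂ : EuclideanSpace ℝ (Fin 3)) (σ σ' : ℤ → ℤ),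 Literature.MathematicalPhysics.StatisticalMechanics.IsHaggSeq σ ∧ Literature.MathematicalPhysics.StatisticalMechanics.IsHaggSeq σ' ∧ L (EuclideanSpace.single (2 : Fin 3) (1 : ℝ)) = m ∧ A '' Λ ⊆ (fun q => L q + s₁) '' Brl σ ∧ B '' Λ ⊆ (fun q => L q + s₂) '' Brl σ'; let Φ : EuclideanSpace ℝ (Fin 3) → ℝ := fun ν => Real.sqrt 2 / 4 * ∑ᶠ w ∈ {w ∈ Λ | ‖w‖ = 1}, |⟪w, ν⟫_ℝ|; let Per : Set (EuclideanSpace ℝ (Fin 3)) → Set (EuclideanSpace ℝ (Fin 3)) → ℝ := fun K S => (⨆ (ξ : EuclideanSpace ℝ (Fin 3) → EuclideanSpace ℝ (Fin 3)) (_ : ContDiff ℝ 1 ξ ∧ HasCompactSupport ξ ∧ ∀ z, ξ z ∈ K), ENNReal.ofReal (∫ z in S, Literature.MathematicalPhysics.StatisticalMechanics.fieldDivergence ξ z)).toReal; let ι : Set (EuclideanSpace ℝ (Fin 3)) → Set (EuclideanSpace ℝ (Fin 3)) → Set (EuclideanSpace ℝ (Fin 3)) → ℝ := fun K S₁ S₂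 => (Per K S₁ + Per K S₂ - Per K (S₁ ∪ S₂)) / 2; let W : (EuclideanSpace ℝ (Fin 3) ≃ₗᵢ[ℝ] EuclideanSpace ℝ (Fin 3)) → Set (EuclideanSpace ℝ (Fin 3)) := fun A => {y | ∀ ν : EuclideanSpace ℝ (Fin 3), ⟪y, ν⟫_ℝ ≤ Φ (A.symm ν)}; let Vol : (n : ℕ) → (Fin n → Set (EuclideanSpace ℝ (Fin 3))) → ℝ := fun n G => (volume (⋃ f : Fin n, G f)).toReal; let Fr : (n : ℕ) → (Fin n → Set (EuclideanSpace ℝ (Fin 3))) → (Fin n → (EuclideanSpace ℝ (Fin 3) ≃ₗᵢ[ℝ] EuclideanSpace ℝ (Fin 3))) → ℝ := fun n G A => ∑ f : Fin n, Per (W (A f)) (G f) - ∑ f, ∑ g, (if f = g then 0 else ι (W (A f)) (G f) (G g)); ∀ (k : ℕ) (H : Fin k → Finset ((EuclideanSpace ℝ (Fin 3)) × ℝ)) (A A' : Fin k → (EuclideanSpace ℝ (Fin 3) ≃ₗᵢ[ℝ] EuclideanSpace ℝ (Fin 3))) (nv : Fin k → Fin k → EuclideanSpace ℝ (Fin 3))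 (τ' : Fin k → Bool) (T : Finset (Fin k)) (ax : Fin k → EuclideanSpace ℝ (Fin 3)) (m u w : EuclideanSpace ℝ (Fin 3)), (∀ j, Bornology.IsBounded (⋂ p ∈ H j, {x : EuclideanSpace ℝ (Fin 3) | ⟪p.1, x⟫_ℝ < p.2})) → (∀ j j', j ≠ j' → Disjoint (⋂ p ∈ H j, {x : EuclideanSpace ℝ (Fin 3) | ⟪p.1, x⟫_ℝ < p.2}) (⋂ p ∈ H j', {x : EuclideanSpace ℝ (Fin 3) | ⟪p.1, x⟫_ℝ < p.2})) → (∀ i j, nv j i = -nv i j) → (∀ j j', j ≠ j' → ‖nv j j'‖ = 1 ∧ ∃ b : ℝ, closure (⋂ p ∈ H j, {x : EuclideanSpace ℝ (Fin 3) | ⟪p.1, x⟫_ℝ < p.2}) ∩ closure (⋂ p ∈ H j', {x : EuclideanSpace ℝ (Fin 3) | ⟪p.1, x⟫_ℝ < p.2}) ⊆ {x | ⟪nv j j', x⟫_ℝ = b}) → (∀ j, j ∉ T → A' j = A j) → (∀ j j', Ax m (A' j) (A' j')) → (∀ j j', τ' j = τ' j' → W (A' j) = W (A' j')) → ‖u‖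 = 1 → ‖w‖ = 1 → ⟪u, m⟫_ℝ = 0 → ⟪w, m⟫_ℝ = 0 → ⟪w, u⟫_ℝ = 0 → (∀ j, u ∈ A' j '' Λ) → (∀ j, (ℝ ∙ u)ᗮ.reflection '' (A' j '' Λ) = A' j '' Λ) → (∀ j ∈ T, ∀ ν : EuclideanSpace ℝ (Fin 3), supportFn (W (A' j)) ν ≤ supportFn (W (A j)) ν + 1 / Real.sqrt 6 * supportFn {y : EuclideanSpace ℝ (Fin 3) | ‖y‖ ≤ 1 ∧ ⟪y, ax j⟫_ℝ = 0} ν) → 6 * (2 : ℝ) ^ ((1 : ℝ) / 3) * (Real.sqrt 2 * Vol k (fun j => (⋂ p ∈ H j, {x : EuclideanSpace ℝ (Fin 3) | ⟪p.1, x⟫_ℝ < p.2}))) ^ ((2 : ℝ) / 3) ≤ Fr k (fun j => (⋂ p ∈ H j, {x : EuclideanSpace ℝ (Fin 3) | ⟪p.1, x⟫_ℝ < p.2})) A + 1 / Real.sqrt 6 * ∑ j ∈ T, (Per {y : EuclideanSpace ℝ (Fin 3) | ‖y‖ ≤ 1 ∧ ⟪y, ax j⟫_ℝ = 0} (⋂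 p ∈ H j, {x : EuclideanSpace ℝ (Fin 3) | ⟪p.1, x⟫_ℝ < p.2}) - ∑ j', (if j = j' then 0 else ι {y : EuclideanSpace ℝ (Fin 3) | ‖y‖ ≤ 1 ∧ ⟪y, ax j⟫_ℝ = 0} (⋂ p ∈ H j, {x : EuclideanSpace ℝ (Fin 3) | ⟪p.1, x⟫_ℝ < p.2}) (⋂ p ∈ H j', {x : EuclideanSpace ℝ (Fin 3) | ⟪p.1, x⟫_ℝ < p.2}))) + 1 / Real.sqrt 6 * ∑ j, ∑ j', (if τ' j = τ' j' then 0 else |⟪w, nv j j'⟫_ℝ| * facetArea (closure (⋂ p ∈ H j, {x : EuclideanSpace ℝ (Fin 3) | ⟪p.1, x⟫_ℝ < p.2}) ∩ closure (⋂ p ∈ H j', {x : EuclideanSpace ℝ (Fin 3) | ⟪p.1, x⟫_ℝ < p.2})) (nv j j')) := by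
  intro Λ Brl Ax Φ Per ι W Vol Fr k H A A' nv τ' T ax m u w hbd hdisj hanti hplane hA'T hAx' hτ' hu hw hum hwm hwu
    hbond' hmir' hgap
  classical
  set Q : Fin k → Set E3 := fun j => ⋂ p ∈ H j, {x : E3 | ⟪p.1, x⟫_ℝ < p.2} with hQ
  -- (1) the cell rung on the relabelled frames
  have hR := rung_singleAxis_cells k H A' nv τ' m u w hbd hdisj hanti hplane hAx' hτ' hu hw hum hwm hwu hbond' hmir'
  -- (2) the body change at cell level (every cell is one polytope)
  have hQpoly : ∀ j, ∃ (k'' : ℕ) (H' : Fin k'' → Finset (E3 × ℝ)), Q j = ⋃ i, polytope (H' i) :=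
    fun j => ⟨1, fun _ => H j, by ext x; simp [hQ, polytope]⟩
  have hQvol : ∀ j, volume (Q j) < ⊤ := fun j => (hbd j).measure_lt_top
  have hWc : ∀ B : E3 ≃ₗᵢ[ℝ] E3, IsCompact (W B) := fun B => isCompact_cruxWulffBody B
  have hWv : ∀ B : E3 ≃ₗᵢ[ℝ] E3, Convex ℝ (W B) := fun B => convex_cruxWulffBody B
  have hW0 : ∀ B : E3 ≃ₗᵢ[ℝ] E3, (0 : E3) ∈ W B := fun B => zero_mem_cruxWulffBody B
  have hWs : ∀ B : E3 ≃ₗᵢ[ℝ] E3, -W B = W B := fun B => neg_cruxWulffBody_eq B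
  have hDc : ∀ v : E3, IsCompact {y : E3 | ‖y‖ ≤ 1 ∧ ⟪y, v⟫_ℝ = 0} := fun v =>
    Metric.isCompact_of_isClosed_isBounded
      ((isClosed_le continuous_norm continuous_const).inter
        (isClosed_eq (continuous_id.inner continuous_const) continuous_const))
      (Metric.isBounded_closedBall.subset (cruxDisc_subset_closedBall v))
  have hDs : ∀ v : E3, -{y : E3 | ‖y‖ ≤ 1 ∧ ⟪y, v⟫_ℝ = 0} = {y : E3 | ‖y‖ ≤ 1 ∧ ⟪y, v⟫_ℝ = 0} := by
    intro v; ext y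
    simp only [Set.mem_neg, Set.mem_setOf_eq, norm_neg, inner_neg_left, neg_eq_zero]
  have hBC := freeEnergy_bodyChange_le_add_family Q hQpoly hQvol hdisj (fun j => W (A j))
    (fun j => hWc (A j)) (fun j => hWv (A j)) (fun j => hW0 (A j)) (fun j => hWs (A j))
    (fun j => W (A' j)) (fun j => hWc (A' j)) (fun j => hWv (A' j)) (fun j => hW0 (A' j))
    (fun j => hWs (A' j)) (fun j => {y : E3 | ‖y‖ ≤ 1 ∧ ⟪y, ax j⟫_ℝ = 0}) (fun j => hDc (ax j))
    (fun j => convex_cruxDisc (ax j)) (fun j => zero_mem_cruxDisc (ax j)) (fun j => hDs (ax j))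
    (fun _ => 1 / Real.sqrt 6) T (fun j hj => by show W (A' j) = W (A j); rw [hA'T j hj]) hgap
  -- (3) assemble
  have e : ∀ (B : Fin k → (E3 ≃ₗᵢ[ℝ] E3)), Fr k Q B =
      ∑ j, (per (W (B j)) (Q j) - ∑ j', (if j = j' then 0 else
        (per (W (B j)) (Q j) + per (W (B j)) (Q j') - per (W (B j)) (Q j ∪ Q j')) / 2)) := by
    intro B
    show (∑ j, Per (W (B j)) (Q j) - ∑ j, ∑ j', (if j = j' then 0 else ι (W (B j)) (Q j) (Q j'))) = _
    rw [← Finset.sum_sub_distrib]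
    rfl
  have eD : 1 / Real.sqrt 6 * ∑ j ∈ T, (Per {y : E3 | ‖y‖ ≤ 1 ∧ ⟪y, ax j⟫_ℝ = 0} (Q j) -
      ∑ j', (if j = j' then 0 else ι {y : E3 | ‖y‖ ≤ 1 ∧ ⟪y, ax j⟫_ℝ = 0} (Q j) (Q j'))) =
      ∑ j ∈ T, 1 / Real.sqrt 6 * (per {y : E3 | ‖y‖ ≤ 1 ∧ ⟪y, ax j⟫_ℝ = 0} (Q j) -
        ∑ j', (if j = j' then 0 else (per {y : E3 | ‖y‖ ≤ 1 ∧ ⟪y, ax j⟫_ℝ = 0} (Q j) +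
          per {y : E3 | ‖y‖ ≤ 1 ∧ ⟪y, ax j⟫_ℝ = 0} (Q j') -
          per {y : E3 | ‖y‖ ≤ 1 ∧ ⟪y, ax j⟫_ℝ = 0} (Q j ∪ Q j')) / 2)) := by
    rw [Finset.mul_sum]
    rfl
  have hBC' : Fr k Q A' ≤ Fr k Q A + 1 / Real.sqrt 6 * ∑ j ∈ T, (Per {y : E3 | ‖y‖ ≤ 1 ∧ ⟪y, ax j⟫_ℝ = 0} (Q j) -
      ∑ j', (if j = j' then 0 else ι {y : E3 | ‖y‖ ≤ 1 ∧ ⟪y, ax j⟫_ℝ = 0} (Q j) (Q j'))) := by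
    rw [e A', e A, eD]
    exact hBC
  exact le_trans hR (by linarith only [hBC'])

/-- **Cell-level relabelling rung, crux form** (`rung_relabel_cells_texture`): as `rung_relabel_texture`
(`…RungRelabel`) but the relabelling is PER CELL — parts of a grain may be flipped; a cut through a grain
between cells of different relabelled classes is charged by the slide `(2/√6)|⟪w, ν⟫|` only (free when the
cut plane contains `w`), a flipped cell by `(1/√6)×` its sin-weighted TRUE exterior area. -/
theorem rung_relabel_cells_texture :
    let Λ : Set (EuclideanSpace ℝ (Fin 3)) := Literature.MathematicalPhysics.StatisticalMechanics.fccStacking 1 (Real.sqrt (2 / 3));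
    let Brl : (ℤ → ℤ) → Set (EuclideanSpace ℝ (Fin 3)) := Literature.MathematicalPhysics.StatisticalMechanics.barlowStacking 1 (Real.sqrt (2 / 3));
    let Ax : EuclideanSpace ℝ (Fin 3) → (EuclideanSpace ℝ (Fin 3) ≃ₗᵢ[ℝ] EuclideanSpace ℝ (Fin 3)) → (EuclideanSpace ℝ (Fin 3) ≃ₗᵢ[ℝ] EuclideanSpace ℝ (Fin 3)) → Prop := fun m A B => ∃ (L : EuclideanSpace ℝ (Fin 3) ≃ₗᵢ[ℝ] EuclideanSpace ℝ (Fin 3)) (s₁ s₂ : EuclideanSpace ℝ (Fin 3)) (σ σ' : ℤ → ℤ), Literature.MathematicalPhysics.StatisticalMechanics.IsHaggSeq σ ∧ Literature.MathematicalPhysics.StatisticalMechanics.IsHaggSeq σ' ∧ L (EuclideanSpace.single (2 : Fin 3) (1 : ℝ)) = m ∧ A '' Λ ⊆ (fun q => L q + s₁) '' Brl σ ∧ B '' Λ ⊆ (fun q => L q + s₂) '' Brl σ';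
    let CoAx : (EuclideanSpace ℝ (Fin 3) ≃ₗᵢ[ℝ] EuclideanSpace ℝ (Fin 3)) → (EuclideanSpace ℝ (Fin 3) ≃ₗᵢ[ℝ] EuclideanSpace ℝ (Fin 3)) → Prop := fun A B => ∃ m, Ax m A B;
    let Φ : EuclideanSpace ℝ (Fin 3) → ℝ := fun ν => Real.sqrt 2 / 4 * ∑ᶠ w ∈ {w ∈ Λ | ‖w‖ = 1}, |⟪w, ν⟫_ℝ|;
    let Per : Set (EuclideanSpace ℝ (Fin 3)) → Set (EuclideanSpace ℝ (Fin 3)) → ℝ := fun K S => (⨆ (ξ : EuclideanSpace ℝ (Fin 3) → EuclideanSpace ℝ (Fin 3)) (_ : ContDiff ℝ 1 ξ ∧ HasCompactSupport ξ ∧ ∀ z, ξ z ∈ K), ENNReal.ofReal (∫ z in S, Literature.MathematicalPhysics.StatisticalMechanics.fieldDivergence ξ z)).toReal;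
    let ι : Set (EuclideanSpace ℝ (Fin 3)) → Set (EuclideanSpace ℝ (Fin 3)) → Set (EuclideanSpace ℝ (Fin 3)) → ℝ := fun K S₁ S₂ => (Per K S₁ + Per K S₂ - Per K (S₁ ∪ S₂)) / 2;
    let W : (EuclideanSpace ℝ (Fin 3) ≃ₗᵢ[ℝ] EuclideanSpace ℝ (Fin 3)) → Set (EuclideanSpace ℝ (Fin 3)) := fun A => {y | ∀ ν : EuclideanSpace ℝ (Fin 3), ⟪y, ν⟫_ℝ ≤ Φ (A.symm ν)};
    let Dsc : EuclideanSpace ℝ (Fin 3) → Set (EuclideanSpace ℝ (Fin 3)) := fun m => {y | ‖y‖ ≤ 1 ∧ ⟪y, m⟫_ℝ = 0};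
    let Tex : (n : ℕ) → (Fin n → Set (EuclideanSpace ℝ (Fin 3))) → (Fin n → (EuclideanSpace ℝ (Fin 3) ≃ₗᵢ[ℝ] EuclideanSpace ℝ (Fin 3))) → (Fin n → Fin n → ℝ) → (Fin n → Fin n → EuclideanSpace ℝ (Fin 3)) → Prop := fun n G A c m => (∀ f : Fin n, Literature.MathematicalPhysics.StatisticalMechanics.HasFinitePerimeter (G f) ∧ volume (G f) < ⊤) ∧ (∀ f g, f ≠ g → Disjoint (G f) (G g)) ∧ (∀ f g, f ≠ g → 0 ≤ c f g) ∧ (∀ f g, f ≠ g → ¬ CoAx (A f) (A g) → m f g = 0 ∧ 1 ≤ c f g) ∧ (∀ f g, f ≠ g → CoAx (A f) (A g) → A f '' Λ ≠ A g '' Λ → Ax (m f g) (A f) (A g) ∧ 1 / 2 ≤ c f g);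
    let En : (n : ℕ) → (Fin n → Set (EuclideanSpace ℝ (Fin 3))) → (Fin n → (EuclideanSpace ℝ (Fin 3) ≃ₗᵢ[ℝ] EuclideanSpace ℝ (Fin 3))) → (Fin n → Fin n → ℝ) → (Fin n → Fin n → EuclideanSpace ℝ (Fin 3)) → ℝ := fun n G A c m => ∑ f : Fin n, Per (W (A f)) (G f) - ∑ f, ∑ g, (if f = g then 0 else ι (W (A f)) (G f) (G g)) + ∑ f, ∑ g, (if f = g then 0 else c f g / 2 * ι (Dsc (m f g)) (G f) (G g));
    let Vol : (n : ℕ) → (Fin n → Set (EuclideanSpace ℝ (Fin 3))) → ℝ := fun n G => (volume (⋃ f : Fin n, G f)).toReal;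
    ∀ (k' : ℕ) (Hc : Fin k' → Finset ((EuclideanSpace ℝ (Fin 3)) × ℝ)) (nv : Fin k' → Fin k' → EuclideanSpace ℝ (Fin 3)),
      (∀ j, Bornology.IsBounded (polytope (Hc j))) →
      (∀ j j', j ≠ j' → Disjoint (polytope (Hc j)) (polytope (Hc j'))) →
      (∀ i j, nv j i = -nv i j) →
      (∀ j j', j ≠ j' → ‖nv j j'‖ = 1 ∧ ∃ b : ℝ,
        closure (polytope (Hc j)) ∩ closure (polytope (Hc j')) ⊆ {x | ⟪nv j j', x⟫_ℝ = b}) →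
    ∀ (n : ℕ) (G : Fin n → Set (EuclideanSpace ℝ (Fin 3)))
      (A : Fin n → (EuclideanSpace ℝ (Fin 3) ≃ₗᵢ[ℝ] EuclideanSpace ℝ (Fin 3)))
      (c : Fin n → Fin n → ℝ) (m : Fin n → Fin n → EuclideanSpace ℝ (Fin 3)),
      Tex n G A c m →
    ∀ (s : Fin n → Finset (Fin k')),
      (∀ f, G f = ⋃ j ∈ s f, polytope (Hc j)) →
      (∀ f g, f ≠ g → Disjoint (s f) (s g)) →
      (∀ j, ∃ f, j ∈ s f) →
    ∀ (κ : Fin n → ℕ), (∀ f g, κ f ≠ κ g → A f '' Λ ≠ A g '' Λ) →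
    ∀ (Ac : Fin k' → (EuclideanSpace ℝ (Fin 3) ≃ₗᵢ[ℝ] EuclideanSpace ℝ (Fin 3))) (τc : Fin k' → Bool)
      (Tc : Finset (Fin k')) (axc : Fin k' → EuclideanSpace ℝ (Fin 3)) (m₀ u w : EuclideanSpace ℝ (Fin 3)),
      (∀ j f, j ∉ Tc → j ∈ s f → Ac j = A f) → (∀ j j', Ax m₀ (Ac j) (Ac j')) →
      (∀ j j', τc j = τc j' → Ac j '' Λ = Ac j' '' Λ) →
      ‖u‖ = 1 → ‖w‖ = 1 → ⟪u, m₀⟫_ℝ = 0 → ⟪w, m₀⟫_ℝ = 0 → ⟪w, u⟫_ℝ = 0 →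
      (∀ j, u ∈ Ac j '' Λ) → (∀ j, (ℝ ∙ u)ᗮ.reflection '' (Ac j '' Λ) = Ac j '' Λ) →
      (∀ j ∈ Tc, ∀ f, j ∈ s f → ∀ ν : EuclideanSpace ℝ (Fin 3),
        supportFn (W (Ac j)) ν ≤ supportFn (W (A f)) ν + 1 / Real.sqrt 6 * supportFn (Dsc (axc j)) ν) →
      2 / Real.sqrt 6 * ((∑ j, ∑ j', (if τc j = τc j' then 0 else
          |⟪w, nv j j'⟫_ℝ| * facetArea (closure (polytope (Hc j)) ∩ closure (polytope (Hc j'))) (nv j j'))) +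
        ∑ j ∈ Tc, (Per (Dsc (axc j)) (polytope (Hc j)) -
          ∑ j', (if j = j' then 0 else ι (Dsc (axc j)) (polytope (Hc j)) (polytope (Hc j'))))) ≤
        1 / 2 * ∑ f, ∑ g, (if κ f = κ g then 0 else ∑ a ∈ s f, ∑ b ∈ s g,
          Real.sqrt (1 - ⟪nv a b, m f g⟫_ℝ ^ 2) * facetArea (closure (polytope (Hc a)) ∩ closure (polytope (Hc b))) (nv a b)) →
    6 * (2 : ℝ) ^ ((1 : ℝ) / 3) * (Real.sqrt 2 * Vol n G) ^ ((2 : ℝ) / 3) ≤ En n G A c m := by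
  intro Λ Brl Ax CoAx Φ Per ι W Dsc Tex En Vol k' Hc nv hbd hdisjQ hanti hplane n G A c m hTex
    s hGs hsdisj hcov κ hκ Ac τc Tc axc m₀ u w hAcT hAxc hτc hu hw hum hwm hwu hbondc hmirc hgapc hTest
  classical
  have hTex' := hTex
  obtain ⟨hfin, hdisjG, hc0, hgen, htwin⟩ := hTex'
  have hvol : ∀ f, volume (G f) < ⊤ := fun f => (hfin f).2
  have hPC := stub_polytopeCalculus
  rcases Nat.eq_zero_or_pos n with hn | hn
  · subst hn
    show 6 * (2 : ℝ) ^ ((1 : ℝ) / 3) * (Real.sqrt 2 * (volume (⋃ f : Fin 0, G f)).toReal) ^ ((2 : ℝ) / 3) ≤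
      ∑ f : Fin 0, Per (W (A f)) (G f) - ∑ f : Fin 0, ∑ g, (if f = g then 0 else ι (W (A f)) (G f) (G g)) +
        ∑ f : Fin 0, ∑ g, (if f = g then 0 else c f g / 2 * ι (Dsc (m f g)) (G f) (G g))
    rw [iUnion_of_empty, measure_empty, ENNReal.toReal_zero, mul_zero, Real.zero_rpow (by norm_num),
      mul_zero]
    simp
  -- cells, their grains
  set Q : Fin k' → Set E3 := fun j => polytope (Hc j) with hQ
  choose gr hgr using hcov
  have hgr_eq : ∀ j f, j ∈ s f → gr j = f := by
    intro j f hj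
    by_contra h
    exact Finset.disjoint_left.1 (hsdisj _ _ h) (hgr j) hj
  have hfilter : ∀ f, Finset.univ.filter (fun j => gr j = f) = s f := by
    intro f; ext j
    simp only [Finset.mem_filter, Finset.mem_univ, true_and]
    exact ⟨fun h => h ▸ hgr j, fun h => hgr_eq j f h⟩
  have hQpoly : ∀ j, ∃ (k : ℕ) (H' : Fin k → Finset (E3 × ℝ)), Q j = ⋃ i, polytope (H' i) :=
    fun j => ⟨1, fun _ => Hc j, by ext x; simp [hQ]⟩
  have hQvol : ∀ j, volume (Q j) < ⊤ := fun j => (hbd j).measure_lt_top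
  set fa : Fin k' → Fin k' → ℝ := fun a b =>
    facetArea (closure (polytope (Hc a)) ∩ closure (polytope (Hc b))) (nv a b) with hfa
  have hfa0 : ∀ a b, 0 ≤ fa a b := fun a b => ENNReal.toReal_nonneg
  -- (1) the cell-level relabelling rung with true cell frames `A (gr j)`
  have hR := rung_relabel_cells k' Hc (fun j => A (gr j)) Ac nv τc Tc axc m₀ u w hbd hdisjQ hanti hplane
    (fun j hj => hAcT j (gr j) hj (hgr j)) hAxc (fun j j' h => wulffBody_eq_of_image_eq (hτc j j' h))
    hu hw hum hwm hwu hbondc hmirc (fun j hj ν => hgapc j hj (gr j) (hgr j) ν)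
  -- (i) volumes agree
  have hUnion : (⋃ j, ⋂ p ∈ Hc j, {x : E3 | ⟪p.1, x⟫_ℝ < p.2}) = ⋃ f, G f := by
    apply subset_antisymm
    · intro x hx
      obtain ⟨j, hj⟩ := mem_iUnion.1 hx
      refine mem_iUnion.2 ⟨gr j, ?_⟩
      rw [hGs]
      exact mem_biUnion (hgr j) hj
    · intro x hx
      obtain ⟨f, hf⟩ := mem_iUnion.1 hx
      rw [hGs] at hf
      obtain ⟨j, -, hj⟩ := mem_iUnion₂.1 hf
      exact mem_iUnion.2 ⟨j, hj⟩
  -- (ii) free energies agree: merge the cells of each grain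
  have hWc : ∀ f, IsCompact (W (A f)) := fun f => isCompact_cruxWulffBody (A f)
  have hWv : ∀ f, Convex ℝ (W (A f)) := fun f => convex_cruxWulffBody (A f)
  have hW0 : ∀ f, (0 : E3) ∈ W (A f) := fun f => zero_mem_cruxWulffBody (A f)
  have hWs : ∀ f, -W (A f) = W (A f) := fun f => neg_cruxWulffBody_eq (A f)
  have hmerge := freeEnergy_eq_merged_texture Q hQpoly hQvol hdisjQ gr Finset.univ
    (fun j => Finset.mem_univ _) (fun f => W (A f)) hWc hWv hW0 hWs
  have hUf : ∀ f, (⋃ j ∈ Finset.univ.filter (fun j => gr j = f), Q j) = G f := by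
    intro f; rw [hfilter, hGs]
  simp only [hUf] at hmerge
  have hFr : (∑ j, Per (W (A (gr j))) (⋂ p ∈ Hc j, {x : E3 | ⟪p.1, x⟫_ℝ < p.2}) -
      ∑ j, ∑ j', (if j = j' then 0 else ι (W (A (gr j))) (⋂ p ∈ Hc j, {x : E3 | ⟪p.1, x⟫_ℝ < p.2})
        (⋂ p ∈ Hc j', {x : E3 | ⟪p.1, x⟫_ℝ < p.2}))) =
      ∑ f, Per (W (A f)) (G f) - ∑ f, ∑ g, (if f = g then 0 else ι (W (A f)) (G f) (G g)) := by
    rw [← Finset.sum_sub_distrib, ← Finset.sum_sub_distrib]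
    exact hmerge
  -- (iii) the walls of the texture pay `¼ Z`
  set Z : ℝ := ∑ f, ∑ g, (if κ f = κ g then 0 else ∑ a ∈ s f, ∑ b ∈ s g,
    Real.sqrt (1 - ⟪nv a b, m f g⟫_ℝ ^ 2) * fa a b) with hZ
  have hGpoly : ∀ f, ∃ (k : ℕ) (H : Fin k → Finset (E3 × ℝ)), G f = ⋃ i, polytope (H i) := by
    intro f
    refine ⟨(s f).card, fun i => Hc ((s f).equivFin.symm i), ?_⟩
    rw [hGs f]
    ext x
    simp only [mem_iUnion]
    constructor
    · rintro ⟨j, hj, hx⟩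
      exact ⟨(s f).equivFin ⟨j, hj⟩, by simpa using hx⟩
    · rintro ⟨i, hx⟩
      exact ⟨((s f).equivFin.symm i : Fin k'), ((s f).equivFin.symm i).2, hx⟩
  have hDc : ∀ v : E3, IsCompact (Dsc v) := fun v =>
    Metric.isCompact_of_isClosed_isBounded
      ((isClosed_le continuous_norm continuous_const).inter
        (isClosed_eq (continuous_id.inner continuous_const) continuous_const))
      (Metric.isBounded_closedBall.subset (cruxDisc_subset_closedBall v))
  have hwall : (1 : ℝ) / 4 * Z ≤ ∑ f, ∑ g, (if f = g then 0 else c f g / 2 * ι (Dsc (m f g)) (G f) (G g)) := by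
    rw [hZ, Finset.mul_sum]
    refine Finset.sum_le_sum fun f _ => ?_
    rw [Finset.mul_sum]
    refine Finset.sum_le_sum fun g _ => ?_
    by_cases hfg : f = g
    · subst hfg; simp
    · rw [if_neg hfg]
      have hι0 : 0 ≤ ι (Dsc (m f g)) (G f) (G g) := by
        show 0 ≤ (Per (Dsc (m f g)) (G f) + Per (Dsc (m f g)) (G g) - Per (Dsc (m f g)) (G f ∪ G g)) / 2
        have h := iota_nonneg_of_poly G hGpoly hvol hdisjG (hDc (m f g)) (convex_cruxDisc (m f g))
          (zero_mem_cruxDisc (m f g)) hfg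
        exact div_nonneg h (by norm_num)
      by_cases hκfg : κ f = κ g
      · rw [if_pos hκfg, mul_zero]
        exact mul_nonneg (div_nonneg (hc0 f g hfg) (by norm_num)) hι0
      · rw [if_neg hκfg]
        have hne : A f '' Λ ≠ A g '' Λ := hκ f g hκfg
        have hmc : (‖m f g‖ = 1 ∨ m f g = 0) ∧ 1 / 2 ≤ c f g := by
          by_cases hco : CoAx (A f) (A g)
          · obtain ⟨hAxfg, hc⟩ := htwin f g hfg hco hne
            obtain ⟨L, -, -, -, -, -, -, hLm, -, -⟩ := hAxfg
            refine ⟨Or.inl ?_, hc⟩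
            rw [← hLm, LinearIsometryEquiv.norm_map, PiLp.norm_single, norm_one]
          · obtain ⟨hm0, hc⟩ := hgen f g hfg hco
            exact ⟨Or.inr hm0, by linarith⟩
        have hιlow : ∑ a ∈ s f, ∑ b ∈ s g, Real.sqrt (1 - ⟪nv a b, m f g⟫_ℝ ^ 2) * fa a b ≤
            ι (Dsc (m f g)) (G f) (G g) := by
          have h := sinSum_le_iota_of_polytopeCalculus' hPC hmc.1 Hc nv hbd hdisjQ hanti hplane
            (hsdisj f g hfg)
          have e1 : (⋃ j ∈ s f, polytope (Hc j)) = G f := (hGs f).symm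
          have e2 : (⋃ j ∈ s g, polytope (Hc j)) = G g := (hGs g).symm
          have e3 : (⋃ j ∈ s f ∪ s g, polytope (Hc j)) = G f ∪ G g := by
            rw [Finset.set_biUnion_union, e1, e2]
          rw [e1, e2, e3] at h
          exact h
        have hZfg0 : 0 ≤ ∑ a ∈ s f, ∑ b ∈ s g, Real.sqrt (1 - ⟪nv a b, m f g⟫_ℝ ^ 2) * fa a b :=
          Finset.sum_nonneg fun a _ => Finset.sum_nonneg fun b _ =>
            mul_nonneg (Real.sqrt_nonneg _) (hfa0 a b)
        nlinarith [hιlow, hmc.2, hι0, hZfg0]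
  -- (iv) assemble
  show 6 * (2 : ℝ) ^ ((1 : ℝ) / 3) * (Real.sqrt 2 * (volume (⋃ f, G f)).toReal) ^ ((2 : ℝ) / 3) ≤
    ∑ f, Per (W (A f)) (G f) - ∑ f, ∑ g, (if f = g then 0 else ι (W (A f)) (G f) (G g)) +
      ∑ f, ∑ g, (if f = g then 0 else c f g / 2 * ι (Dsc (m f g)) (G f) (G g))
  set Sw : ℝ := ∑ j, ∑ j', (if τc j = τc j' then 0 else |⟪w, nv j j'⟫_ℝ| * fa j j') with hSw
  set FrD : ℝ := ∑ j ∈ Tc, (Per (Dsc (axc j)) (polytope (Hc j)) -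
    ∑ j', (if j = j' then 0 else ι (Dsc (axc j)) (polytope (Hc j)) (polytope (Hc j')))) with hFrD
  have hR' : 6 * (2 : ℝ) ^ ((1 : ℝ) / 3) * (Real.sqrt 2 * (volume (⋃ f, G f)).toReal) ^ ((2 : ℝ) / 3) ≤
      (∑ f, Per (W (A f)) (G f) - ∑ f, ∑ g, (if f = g then 0 else ι (W (A f)) (G f) (G g))) +
        1 / Real.sqrt 6 * FrD + 1 / Real.sqrt 6 * Sw := by
    refine le_trans (le_of_eq ?_) (le_trans hR (le_of_eq ?_))
    · show _ = 6 * (2 : ℝ) ^ ((1 : ℝ) / 3) *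
        (Real.sqrt 2 * (volume (⋃ j, ⋂ p ∈ Hc j, {x : E3 | ⟪p.1, x⟫_ℝ < p.2})).toReal) ^ ((2 : ℝ) / 3)
      rw [hUnion]
    · show (∑ j, Per (W (A (gr j))) (⋂ p ∈ Hc j, {x : E3 | ⟪p.1, x⟫_ℝ < p.2}) -
          ∑ j, ∑ j', (if j = j' then 0 else ι (W (A (gr j))) (⋂ p ∈ Hc j, {x : E3 | ⟪p.1, x⟫_ℝ < p.2})
            (⋂ p ∈ Hc j', {x : E3 | ⟪p.1, x⟫_ℝ < p.2}))) +
          1 / Real.sqrt 6 * FrD + 1 / Real.sqrt 6 * Sw = _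
      rw [hFr]
  have h6 : (0 : ℝ) < Real.sqrt 6 := Real.sqrt_pos.2 (by norm_num)
  have hY : 1 / Real.sqrt 6 * FrD + 1 / Real.sqrt 6 * Sw ≤ (1 : ℝ) / 4 * Z := by
    have e : 1 / Real.sqrt 6 * FrD + 1 / Real.sqrt 6 * Sw = (1 / 2) * (2 / Real.sqrt 6 * (Sw + FrD)) := by
      ring
    rw [e]
    linarith only [hTest]
  linarith only [hR', hY, hwall]

end Summit.Ventures.Crystal3D.Cruxes.PolycrystalWulffBound.PolyDensity

end
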